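import Literature.AnabelianGeometry.SemiGraphs.TemperedPiFullLemmas
import Literature.AnabelianGeometry.SemiGraphs.CoveringHomImage

/-!
# The transition maps `𝒢_{∞,N'} ⟶ 𝒢_{∞,N}` and the universal morphisms ([SemiAnbd] Prop. 3.6, p. 38)

Sequel to `TemperedPiFullLemmas.lean`: the composite transition morphisms
`coverMap : 𝒢_{∞,N'} ⟶ 𝒢_{∞,N}` (`N ≤ N'`), their compatibility with the universal morphisms
`liftι` (`coverMap ≫ liftι^N = liftι^{N'}`) and fibre-surjectivity; the equivariance of a
`π₁^temp`-map with the level-`n` actions; and the "base change" of a point of `T_{v₀}` within a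
component (`x₂ = τ · x₁`).  These are the reductions used to show that the morphism `T ⟶ T'`
attached to an equivariant `m : T_{v₀} → T'_{v₀}` is well defined.
-/

namespace Literature.AnabelianGeometry.SemiGraphs

namespace ProfiniteSemiGraph

open CategoryTheory

universe u

variable {𝒢 : ProfiniteSemiGraph.{u}}

namespace GaloisLevelData

variable (D : GaloisLevelData 𝒢) (h𝒢 : 𝒢.IsCountable)

/-- The one-step transition morphism `𝒢_{∞,k+1} ⟶ 𝒢_{∞,k}` (projection followed by the base
identification). [cite: MochizukiSemiAnbd2006, Prop 3.6 p.38] -/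
noncomputable def levelMap (k : ℕ) : D.cover h𝒢 (k + 1) ⟶ D.cover h𝒢 k :=
  CovObj.projOver (D.g k) (D.W (k + 1)) h𝒢 ≫ (D.baseIso h𝒢 k).hom

/-- The transition morphisms `𝒢_{∞,N'} ⟶ 𝒢_{∞,N}` for `N ≤ N'`. [cite: MochizukiSemiAnbd2006, Prop 3.6 p.38] -/
noncomputable def coverMap {n m : ℕ} (h : n ≤ m) : D.cover h𝒢 m ⟶ D.cover h𝒢 n :=
  Nat.leRec (motive := fun m _ => (D.cover h𝒢 m ⟶ D.cover h𝒢 n)) (𝟙 _)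
    (fun k _ φ => D.levelMap h𝒢 k ≫ φ) h

/-- `coverMap le_rfl = 𝟙`. [cite: MochizukiSemiAnbd2006, Prop 3.6 p.38] -/
theorem coverMap_self (n : ℕ) : D.coverMap h𝒢 (le_refl n) = 𝟙 _ := Nat.leRec_self _ _

/-- `coverMap` one level up. [cite: MochizukiSemiAnbd2006, Prop 3.6 p.38] -/
theorem coverMap_succ {n k : ℕ} (h : n ≤ k) (h' : n ≤ k + 1) :
    D.coverMap h𝒢 h' = D.levelMap h𝒢 k ≫ D.coverMap h𝒢 h :=
  Nat.leRec_succ _ _ h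

/-- The one-step transition is compatible with the universal morphisms.
[cite: MochizukiSemiAnbd2006, Prop 3.6 p.38] -/
theorem levelMap_liftι (T : CovObj 𝒢) (t : (T.SV D.v₀).obj.V) (k : ℕ)
    (hs : (D.S k).Splits (T.component (Sum.inl ⟨D.v₀, t⟩)))
    (hs' : (D.S (k + 1)).Splits (T.component (Sum.inl ⟨D.v₀, t⟩))) :
    D.levelMap h𝒢 k ≫ D.liftι h𝒢 T t k hs = D.liftι h𝒢 T t (k + 1) hs' := by
  have hfac := D.projOver_comp_liftHom h𝒢 T t k (D.x k) (D.hx k) hs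
  unfold liftι levelMap
  rw [Category.assoc, ← Category.assoc (D.baseIso h𝒢 k).hom]
  exact congrArg (fun φ => φ ≫ T.componentι (Sum.inl ⟨D.v₀, t⟩)) hfac

/-- Higher levels split whatever lower levels split. [cite: MochizukiSemiAnbd2006, Prop 3.6 p.38] -/
theorem splits_of_le {X : CovObj 𝒢} {n k : ℕ} (h : n ≤ k) (hs : (D.S n).Splits X) : (D.S k).Splits X := by
  induction k, h using Nat.le_induction with
  | base => exact hs
  | succ k _ ih => exact CovObj.Splits.of_hom (D.g k) ih

/-- **`coverMap ≫ liftι^N = liftι^{N'}`.** [cite: MochizukiSemiAnbd2006, Prop 3.6 p.38] -/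
theorem coverMap_liftι (T : CovObj 𝒢) (t : (T.SV D.v₀).obj.V) {n m : ℕ} (h : n ≤ m)
    (hsn : (D.S n).Splits (T.component (Sum.inl ⟨D.v₀, t⟩)))
    (hsm : (D.S m).Splits (T.component (Sum.inl ⟨D.v₀, t⟩))) :
    D.coverMap h𝒢 h ≫ D.liftι h𝒢 T t n hsn = D.liftι h𝒢 T t m hsm := by
  induction m, h using Nat.le_induction with
  | base => rw [coverMap_self, Category.id_comp]
  | succ k hk ih =>
    rw [D.coverMap_succ h𝒢 hk, Category.assoc, ih (D.splits_of_le hk hsn)]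
    exact D.levelMap_liftι h𝒢 T t k _ hsm

/-- `levelMap` is surjective on vertex fibres. [cite: MochizukiSemiAnbd2006, Prop 3.6 p.38] -/
theorem levelMap_fV_surjective (k : ℕ) (v : 𝒢.graph.Vertex) :
    Function.Surjective ((D.levelMap h𝒢 k).fV v).hom.hom := by
  intro u
  obtain ⟨w, hw⟩ := CovObj.univCoverOverMap_fV_surjective (D.g k) (D.W (k + 1)) h𝒢 v
    ((((D.baseIso h𝒢 k).inv).fV v).hom.hom u)
  refine ⟨w, ?_⟩
  change (((D.baseIso h𝒢 k).hom).fV v).hom.hom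
    (((CovObj.projOver (D.g k) (D.W (k + 1)) h𝒢).fV v).hom.hom w) = u
  rw [show ((CovObj.projOver (D.g k) (D.W (k + 1)) h𝒢).fV v).hom.hom w =
    (((D.baseIso h𝒢 k).inv).fV v).hom.hom u from hw]
  change ((((D.baseIso h𝒢 k).inv ≫ (D.baseIso h𝒢 k).hom)).fV v).hom.hom u = u
  rw [Iso.inv_hom_id]
  rfl

/-- `coverMap` is surjective on vertex fibres. [cite: MochizukiSemiAnbd2006, Prop 3.6 p.38] -/
theorem coverMap_fV_surjective {n m : ℕ} (h : n ≤ m) (v : 𝒢.graph.Vertex) :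
    Function.Surjective ((D.coverMap h𝒢 h).fV v).hom.hom := by
  induction m, h using Nat.le_induction with
  | base =>
    rw [coverMap_self]
    exact fun u => ⟨u, rfl⟩
  | succ k hk ih =>
    rw [D.coverMap_succ h𝒢 hk]
    intro u
    obtain ⟨u', hu'⟩ := ih u
    obtain ⟨u'', hu''⟩ := D.levelMap_fV_surjective h𝒢 k v u'
    exact ⟨u'', by
      change ((D.coverMap h𝒢 hk).fV v).hom.hom (((D.levelMap h𝒢 k).fV v).hom.hom u'') = u
      rw [hu'', hu']⟩

section Equivariant

variable (T T' : CovObj 𝒢) (lev : (T.SV D.v₀).obj.V → ℕ)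
  (hlev : ∀ (t : (T.SV D.v₀).obj.V) (n : ℕ), lev t ≤ n →
    (D.S n).Splits (T.component (Sum.inl ⟨D.v₀, t⟩)))
  (lev' : (T'.SV D.v₀).obj.V → ℕ)
  (hlev' : ∀ (t : (T'.SV D.v₀).obj.V) (n : ℕ), lev' t ≤ n →
    (D.S n).Splits (T'.component (Sum.inl ⟨D.v₀, t⟩)))
  (m : D.fibreObj h𝒢 T lev hlev ⟶ D.fibreObj h𝒢 T' lev' hlev')

/-- A `π₁^temp`-map commutes with the level-`n` actions (levels `n ≥ lev x, lev' (m x)`).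
[cite: MochizukiSemiAnbd2006, Prop 3.6(ii) p.38] -/
theorem map_actAt (x : (T.SV D.v₀).obj.V) (n : ℕ) (hn : lev x ≤ n) (hn' : lev' (m.hom.hom x) ≤ n)
    (σ : D.Gal h𝒢 n) :
    m.hom.hom (D.actAt h𝒢 T x n (hlev x n hn) σ) =
      D.actAt h𝒢 T' (m.hom.hom x) n (hlev' _ n hn') σ := by
  obtain ⟨γ, rfl⟩ := D.proj_surjective h𝒢 n σ
  rw [D.actAt_proj_eq h𝒢 T lev hlev x γ n hn, D.actAt_proj_eq h𝒢 T' lev' hlev' _ γ n hn']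
  exact ConcreteCategory.congr_hom (m.hom.comm γ) x

end Equivariant

/-- **Base change within a component**: a point `x₂ ∈ T_{v₀}` in the component of `x₁` is
`τ · x₁` for some `τ ∈ G_n`. [cite: MochizukiSemiAnbd2006, Prop 3.6(ii) p.38] -/
theorem exists_actAt_eq (T : CovObj 𝒢) (x₁ x₂ : (T.SV D.v₀).obj.V) (n : ℕ)
    (hs : (D.S n).Splits (T.component (Sum.inl ⟨D.v₀, x₁⟩)))
    (h : T.SameComponent (Sum.inl ⟨D.v₀, x₁⟩) (Sum.inl ⟨D.v₀, x₂⟩)) :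
    ∃ τ : D.Gal h𝒢 n, D.actAt h𝒢 T x₁ n hs τ = x₂ := by
  have h' : T.SameComponent
      (Sum.inl ⟨D.v₀, ((D.liftι h𝒢 T x₁ n hs).fV D.v₀).hom.hom (D.bp n)⟩) (Sum.inl ⟨D.v₀, x₂⟩) := by
    rw [D.liftι_bp]; exact h
  obtain ⟨w, hw⟩ := CovHom.exists_preimage_of_sameComponent (D.liftι h𝒢 T x₁ n hs) (D.bp n) x₂ h'
  obtain ⟨η, hη⟩ := (D.S n).exists_aut_apply_eq' h𝒢 (D.W n) (D.htrans n) (D.bp n) w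
  refine ⟨(η : D.Gal h𝒢 n)⁻¹, ?_⟩
  rw [← D.liftι_inv_bp, inv_inv]
  change ((D.liftι h𝒢 T x₁ n hs).fV D.v₀).hom.hom ((η.hom.fV D.v₀).hom.hom (D.bp n)) = x₂
  rw [hη, hw]

end GaloisLevelData

end ProfiniteSemiGraph

end Literature.AnabelianGeometry.SemiGraphs
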